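import Summits.QuantumFields.BalabanUV.Beta.CompositeMixedWardGraded
import Summits.QuantumFields.BalabanUV.Beta.GAN24.SymLinKernelExpansion
import Summits.QuantumFields.BalabanUV.Beta.SymAveragingWardRootedStencils
import Summits.QuantumFields.BalabanUV.Beta.SymMixedWardSiteLaw
import Summits.QuantumFields.BalabanUV.Beta.SymAveragingMixedJetStructure

/-!
# `BalabanUV.Beta.CompositeMixedWardGradedSym` — row D1 ∕ (C1), PART 110d: an1's (0.4)-SYMMETRISED BRICKS OBEY THE THREE WINDOW LAWS; HENCE THE SYMMETRISED
# MIXED WARD LAW OF THE GRADED COMPOSITE MIXED KERNEL OVER THE RECORD's SYM BRICKS, ORDINARY FORM, EVERY DEPTH, HYPOTHESIS-FREE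

HONEST DEPENDENCY (page 1, mandatory): continuum YM on T⁴ ⇐ BetaPertH ∧ nine spine estimates (0/9 proved); BetaPertH ⇐ (D1) ∧ (D4) ∧ CAP+tail;
G-an2-4 gates asym, D1 and NE2/3/4.  HONEST FRAMING (cell contract, verbatim): «discharging `BetaPertH` makes Bałaban's UV stability UNCONDITIONAL —
a real constructive-QFT result; it is NOT the continuum limit and NOT the Clay problem.»  ABSOLUTE RULE (cell charter, verbatim): «No internally-minted
statement may enter as a cited fact. Every hypothesis is either kernel-proved in this package or a verbatim quotation of a PUBLISHED theorem with page
reference. The manuscript(s) under audit are NOT citable for their own disputed steps — they are the thing under adjudication; programme-internal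
(2001/route/tribunal) claims are never citable.»

WHY (row-D1 owner an2 gen 86; FINDING AN2-86-2, journal [AN2-G86-S-11]).  PART 110e (`CompositeMixedWardGraded.compMixKerG_div_bg_symm`) proved, for ANY bricks
under the window laws `hℓW h𝓋W h𝓉W` and an antisymmetric Hessian brick, that an2's GRADED composite mixed kernel `compMixKerG` obeys the `f ↔ f′`-symmetrised
background Ward law in the ordinary finest-leg form at every depth.  The RECORD's composite tables (`tabsComp`, the (III′) literal's depth-≥2 objects, e.g.
`CombMixedT2EvenGradedLetters`) are built from an1's (0.4)-SYMMETRISED one-step bricks `symLinKerAt ∕ symVhKerAt ∕ symHessKerAt ∕ symMixKerAt (toSite r) L`.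
§1 discharges the three window laws for these bricks (box root `r`, `1 ≤ L`, any coarse weight `G`): `symLinKerAt_window_dz` (GAN24 `tsum_sum_symLinKerAt_mul_grad`
read on the window), `symVhKerAt_window_dz` (an2 `symVhKerAt_div_right` summed by parts — PART 105a's proof in the sym letters), `symMixKerAt_window_dz` (an2
`SymMixedWardSiteLaw.symMixKerAt_siteWard` summed by parts — PART 110c's proof in the sym letters).  §2 the hypothesis-free instance
`compMixKerG_div_bg_symm_sym` (antisymmetry `symHessKerAt_swap`).

WHAT: [folklore] `tsum`∕finite-sum bookkeeping BY NAME; no `def`, no `def … : Prop`, nothing cited, 0 sorry.  Nothing of Bałaban's asserted, valued or discharged;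
0 estimates; 0∕4 row-D1 binders; (W)_j NOT claimed (kernel-level symmetrised law only); NOT (C1), NOT D1, NEVER «G-an2-4 closed», NOT BetaPertH, NOT continuum,
NOT Clay.  Row D1 ∕ (C1) OWNER «beta-an2», gen 86, 2026-08-30.  No existing file touched.
-/

noncomputable section

open Finset
open scoped BigOperators
open Literature.MathematicalPhysics.QuantumFieldTheory.Balaban1983to89
open Literature.MathematicalPhysics.QuantumFieldTheory.Balaban1983to89.Beta
open AffineAveraging (Site box toSite unitVec)
open AveragingHessianKernels (Bond Near)
open Summit.QuantumFields.BalabanUV.Beta.CompositeVertexKernelRec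
open Summit.QuantumFields.BalabanUV.Beta.CompositeMixedTableGraded (compMixKerG)
open Summit.QuantumFields.BalabanUV.Beta.LinearGaugeVH (nearBox mem_nearBox)
open Summit.QuantumFields.BalabanUV.Beta.SymAveragingHessianCounts (symLinKerAt symVhKerAt symHessKerAt symHessKerAt_swap symVhKerAt_eq_zero_right)
open Summit.QuantumFields.BalabanUV.Beta.SymAveragingMixedJetTables (symMixKerAt symTTab symTTab_eq_zero₃)
open Summit.QuantumFields.BalabanUV.Beta.SymAveragingWardRootedStencils (symVhKerAt_div_right)
open Summit.QuantumFields.BalabanUV.Beta.SymMixedWardSiteLaw (symMixKerAt_siteWard)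
open Summit.QuantumFields.BalabanUV.Beta.GAN24.SymLinKernelExpansion (tsum_sum_symLinKerAt_mul_grad symLinKerAt_eq_zero_of_not_mem)
open Summit.QuantumFields.BalabanUV.Beta.CompositeVertexWardRooted (sum_offs_eq_sum_nearBox)
open Summit.QuantumFields.BalabanUV.Beta.CompositeMixedWardGraded (compMixKerG_div_bg_symm)

namespace Summit.QuantumFields.BalabanUV.Beta.CompositeMixedWardGradedSym

variable {d : ℕ}

/-! ## §1 The three window laws for an1's (0.4)-symmetrised bricks -/

section Sym

variable {L : ℕ} {r : Fin (d + 1) → ℕ}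

/-- [folklore] **THE WINDOW PURE-GAUGE LAW OF THE (0.4)-SYMMETRISED LINEAR ROW** (`hℓW` for `symLinKerAt (toSite r) L`, box root, `1 ≤ L`): the window row maps a fine pure
gauge to the coarse pure gauge read at the block roots — GAN24 `tsum_sum_symLinKerAt_mul_grad` restricted to the window by the row's support. -/
theorem symLinKerAt_window_dz (hL : 1 ≤ L) (hr : r ∈ box (d + 1) L) (μ : Fin (d + 1)) (y : Site (d + 1)) (G : Site (d + 1) → ℝ) :
    ∑ κ : Fin (d + 1), ∑ e ∈ offs L, symLinKerAt (toSite r) L μ y (κ, (L : ℤ) • y + e) * (G ((L : ℤ) • y + e + unitVec κ) - G ((L : ℤ) • y + e)) =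
      G ((L : ℤ) • y + toSite r + (L : ℤ) • unitVec μ) - G ((L : ℤ) • y + toSite r) := by
  classical
  rw [← tsum_sum_symLinKerAt_mul_grad hL hr G μ y, Finset.sum_comm,
    tsum_eq_sum (s := nearBox L y) (fun x hx => Finset.sum_eq_zero fun α _ => by rw [symLinKerAt_eq_zero_of_not_mem hr μ hx α, zero_mul])]
  exact sum_offs_eq_sum_nearBox y (fun x => ∑ α : Fin (d + 1), symLinKerAt (toSite r) L μ y (α, x) * (G (x + unitVec α) - G x))

/-- [folklore] **THE WINDOW BACKGROUND LAW OF an1's (0.4)-SYMMETRISED VERTEX BRICK** (`h𝓋W` for `symVhKerAt (toSite r) L`, box root, `1 ≤ L`), for ANY coarse weight `G`: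
`Σ_κ Σ_{e ∈ offs} symVhKerAt f (κ, L•y+e) · (G (L•y+e+e_κ) − G (L•y+e)) = (G (L•y+ρ) − G f.2) · symLinKerAt f` — an2's sym site law `symVhKerAt_div_right` summed by parts
(the proof is PART 105a's `vhKerAt_window_dz` verbatim in the sym letters). -/
theorem symVhKerAt_window_dz (hL : 1 ≤ L) (hr : r ∈ box (d + 1) L) (μ : Fin (d + 1)) (y : Site (d + 1)) (f : Bond (d + 1)) (G : Site (d + 1) → ℝ) :
    ∑ κ : Fin (d + 1), ∑ e ∈ offs L, symVhKerAt (toSite r) L μ y f (κ, (L : ℤ) • y + e) * (G ((L : ℤ) • y + e + unitVec κ) - G ((L : ℤ) • y + e)) =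
      (G ((L : ℤ) • y + toSite r) - G f.2) * symLinKerAt (toSite r) L μ y f := by
  classical
  -- support of the brick in its background slot
  have hsupp : ∀ (κ : Fin (d + 1)) (x : Site (d + 1)), x ∉ nearBox L y → symVhKerAt (toSite r) L μ y f (κ, x) = 0 :=
    fun κ x hx => symVhKerAt_eq_zero_right hr f (f' := (κ, x)) (fun h => hx (mem_nearBox.2 h))
  -- the shifted support: `x ↦ 𝓋 (κ, x − e_κ)` vanishes off `nearBox + e_κ`
  have hsupp' : ∀ (κ : Fin (d + 1)) (x : Site (d + 1)), x ∉ (nearBox L y).image (fun x' => x' + unitVec κ) →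
      symVhKerAt (toSite r) L μ y f (κ, x - unitVec κ) = 0 := by
    intro κ x hx
    apply hsupp κ (x - unitVec κ)
    intro hmem
    exact hx (Finset.mem_image.2 ⟨x - unitVec κ, hmem, sub_add_cancel x (unitVec κ)⟩)
  -- summability (finite supports)
  have hs1 : ∀ κ : Fin (d + 1), Summable fun x : Site (d + 1) => symVhKerAt (toSite r) L μ y f (κ, x - unitVec κ) * G x :=
    fun κ => summable_of_ne_finset_zero (s := (nearBox L y).image (fun x' => x' + unitVec κ)) fun x hx => by rw [hsupp' κ x hx, zero_mul]
  have hs2 : ∀ κ : Fin (d + 1), Summable fun x : Site (d + 1) => symVhKerAt (toSite r) L μ y f (κ, x) * G x :=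
    fun κ => summable_of_ne_finset_zero (s := nearBox L y) fun x hx => by rw [hsupp κ x hx, zero_mul]
  have hs3 : ∀ κ : Fin (d + 1), Summable fun x : Site (d + 1) =>
      (symVhKerAt (toSite r) L μ y f (κ, x - unitVec κ) - symVhKerAt (toSite r) L μ y f (κ, x)) * G x :=
    fun κ => ((hs1 κ).sub (hs2 κ)).congr fun x => by ring
  -- (1) each window sum as a sum over `ℤ^{d+1}`, the translated one re-indexed
  have key : ∀ κ : Fin (d + 1), ∑ e ∈ offs L, symVhKerAt (toSite r) L μ y f (κ, (L : ℤ) • y + e) * (G ((L : ℤ) • y + e + unitVec κ) - G ((L : ℤ) • y + e)) =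
      ∑' x : Site (d + 1), (symVhKerAt (toSite r) L μ y f (κ, x - unitVec κ) - symVhKerAt (toSite r) L μ y f (κ, x)) * G x := by
    intro κ
    have hA : ∑' x : Site (d + 1), symVhKerAt (toSite r) L μ y f (κ, x - unitVec κ) * G x =
        ∑ e ∈ offs L, symVhKerAt (toSite r) L μ y f (κ, (L : ℤ) • y + e) * G ((L : ℤ) • y + e + unitVec κ) := by
      rw [← (Equiv.addRight (unitVec κ)).tsum_eq (fun x : Site (d + 1) => symVhKerAt (toSite r) L μ y f (κ, x - unitVec κ) * G x)]
      simp only [Equiv.coe_addRight, add_sub_cancel_right]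
      rw [tsum_eq_sum (s := nearBox L y) (fun x hx => by rw [hsupp κ x hx, zero_mul])]
      exact (sum_offs_eq_sum_nearBox y (fun x => symVhKerAt (toSite r) L μ y f (κ, x) * G (x + unitVec κ))).symm
    have hB : ∑' x : Site (d + 1), symVhKerAt (toSite r) L μ y f (κ, x) * G x =
        ∑ e ∈ offs L, symVhKerAt (toSite r) L μ y f (κ, (L : ℤ) • y + e) * G ((L : ℤ) • y + e) := by
      rw [tsum_eq_sum (s := nearBox L y) (fun x hx => by rw [hsupp κ x hx, zero_mul])]
      exact (sum_offs_eq_sum_nearBox y (fun x => symVhKerAt (toSite r) L μ y f (κ, x) * G x)).symm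
    calc ∑ e ∈ offs L, symVhKerAt (toSite r) L μ y f (κ, (L : ℤ) • y + e) * (G ((L : ℤ) • y + e + unitVec κ) - G ((L : ℤ) • y + e))
        = ∑ e ∈ offs L, symVhKerAt (toSite r) L μ y f (κ, (L : ℤ) • y + e) * G ((L : ℤ) • y + e + unitVec κ) -
            ∑ e ∈ offs L, symVhKerAt (toSite r) L μ y f (κ, (L : ℤ) • y + e) * G ((L : ℤ) • y + e) := by
          simp only [mul_sub, Finset.sum_sub_distrib]
      _ = ∑' x : Site (d + 1), symVhKerAt (toSite r) L μ y f (κ, x - unitVec κ) * G x - ∑' x : Site (d + 1), symVhKerAt (toSite r) L μ y f (κ, x) * G x := by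
          rw [hA, hB]
      _ = ∑' x : Site (d + 1), (symVhKerAt (toSite r) L μ y f (κ, x - unitVec κ) * G x - symVhKerAt (toSite r) L μ y f (κ, x) * G x) :=
          ((hs1 κ).tsum_sub (hs2 κ)).symm
      _ = _ := tsum_congr fun x => by ring
  -- the two point masses of the jump
  have hsP : Summable fun x : Site (d + 1) => (if (L : ℤ) • y + toSite r = x then (1 : ℝ) else 0) * (symLinKerAt (toSite r) L μ y f * G x) :=
    summable_of_ne_finset_zero (s := {(L : ℤ) • y + toSite r}) fun x hx => by
      rw [Finset.mem_singleton] at hx; rw [if_neg (fun h => hx h.symm), zero_mul]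
  have hsQ : Summable fun x : Site (d + 1) => (if f.2 = x then (1 : ℝ) else 0) * (symLinKerAt (toSite r) L μ y f * G x) :=
    summable_of_ne_finset_zero (s := {f.2}) fun x hx => by
      rw [Finset.mem_singleton] at hx; rw [if_neg (fun h => hx h.symm), zero_mul]
  -- (2) assemble: Σ_κ (S₁ − S₂) = Σ' x, G x · Σ_κ (𝓋 (κ, x − e_κ) − 𝓋 (κ, x)) = Σ' x, G x · jump · q¹
  calc ∑ κ : Fin (d + 1), ∑ e ∈ offs L, symVhKerAt (toSite r) L μ y f (κ, (L : ℤ) • y + e) * (G ((L : ℤ) • y + e + unitVec κ) - G ((L : ℤ) • y + e))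
      = ∑ κ : Fin (d + 1), ∑' x : Site (d + 1), (symVhKerAt (toSite r) L μ y f (κ, x - unitVec κ) - symVhKerAt (toSite r) L μ y f (κ, x)) * G x :=
        Finset.sum_congr rfl fun κ _ => key κ
    _ = ∑' x : Site (d + 1), ∑ κ : Fin (d + 1), (symVhKerAt (toSite r) L μ y f (κ, x - unitVec κ) - symVhKerAt (toSite r) L μ y f (κ, x)) * G x :=
        (Summable.tsum_finsetSum fun κ _ => hs3 κ).symm
    _ = ∑' x : Site (d + 1), ((if (L : ℤ) • y + toSite r = x then (1 : ℝ) else 0) - (if f.2 = x then (1 : ℝ) else 0)) *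
          symLinKerAt (toSite r) L μ y f * G x := by
        refine tsum_congr fun x => ?_
        rw [← Finset.sum_mul, symVhKerAt_div_right hL (toSite r) μ y f x]
    _ = (∑' x : Site (d + 1), (if (L : ℤ) • y + toSite r = x then (1 : ℝ) else 0) * (symLinKerAt (toSite r) L μ y f * G x)) -
          ∑' x : Site (d + 1), (if f.2 = x then (1 : ℝ) else 0) * (symLinKerAt (toSite r) L μ y f * G x) := by
        rw [← hsP.tsum_sub hsQ]
        exact tsum_congr fun x => by ring
    _ = (G ((L : ℤ) • y + toSite r) - G f.2) * symLinKerAt (toSite r) L μ y f := by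
        rw [tsum_eq_single ((L : ℤ) • y + toSite r) (fun x hx => by rw [if_neg (fun h => hx h.symm), zero_mul]),
          tsum_eq_single f.2 (fun x hx => by rw [if_neg (fun h => hx h.symm), zero_mul]), if_pos rfl, if_pos rfl]
        ring

/-- [folklore] support of the (0.4)-symmetrised mixed brick in its background slot (an2 `symTTab_eq_zero₃`). -/
theorem symMixKerAt_eq_zero_bg (hr : r ∈ box (d + 1) L) (μ : Fin (d + 1)) (y : Site (d + 1)) (f f' : Bond (d + 1)) {κ : Fin (d + 1)}
    {x : Site (d + 1)} (hx : ¬ Near L y x) : symMixKerAt (toSite r) L μ y (κ, x) f f' = 0 := by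
  show ((symTTab (toSite r) L μ y f f' (κ, x) : ℚ) : ℝ) = 0
  rw [symTTab_eq_zero₃ hr μ y f f' (g := (κ, x)) hx, Rat.cast_zero]

/-- [folklore] an2's sym site law (`SymMixedWardSiteLaw.symMixKerAt_siteWard`), `1 ≤ L` form: the background divergence of the sym mixed brick at the site `u` is
`2·symHessKerAt f f′ · ([u = L•y + ρ] − [u = f.2])`. -/
theorem symMixKerAt_div_bg (hL : 1 ≤ L) (ρ : Site (d + 1)) (μ : Fin (d + 1)) (y u : Site (d + 1)) (f f' : Bond (d + 1)) :
    ∑ κ : Fin (d + 1), (symMixKerAt ρ L μ y (κ, u - unitVec κ) f f' - symMixKerAt ρ L μ y (κ, u) f f') =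
      2 * symHessKerAt ρ L μ y f f' * ((if u = (L : ℤ) • y + ρ then (1 : ℝ) else 0) - (if u = f.2 then (1 : ℝ) else 0)) :=
  symMixKerAt_siteWard (show L ≠ 0 by omega) ρ μ y u f f'

/-- [folklore] **THE WINDOW BACKGROUND LAW OF THE (0.4)-SYMMETRISED MIXED BRICK** (`h𝓉W` for `symMixKerAt (toSite r) L`, box root, `1 ≤ L`), for ANY coarse weight `G`:
`Σ_κ Σ_{e ∈ offs} symMixKerAt (κ, L•y+e) f f′ · (G (L•y+e+e_κ) − G (L•y+e)) = 2 · symHessKerAt f f′ · (G (L•y+ρ) − G f.2)` — `symMixKerAt_div_bg` summed by parts over `ℤ^{d+1}`. -/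
theorem symMixKerAt_window_dz (hL : 1 ≤ L) (hr : r ∈ box (d + 1) L) (μ : Fin (d + 1)) (y : Site (d + 1)) (f f' : Bond (d + 1)) (G : Site (d + 1) → ℝ) :
    ∑ κ : Fin (d + 1), ∑ e ∈ offs L, symMixKerAt (toSite r) L μ y (κ, (L : ℤ) • y + e) f f' * (G ((L : ℤ) • y + e + unitVec κ) - G ((L : ℤ) • y + e)) =
      2 * symHessKerAt (toSite r) L μ y f f' * (G ((L : ℤ) • y + toSite r) - G f.2) := by
  classical
  have hsupp : ∀ (κ : Fin (d + 1)) (x : Site (d + 1)), x ∉ nearBox L y → symMixKerAt (toSite r) L μ y (κ, x) f f' = 0 :=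
    fun κ x hx => symMixKerAt_eq_zero_bg hr μ y f f' (fun h => hx (mem_nearBox.2 h))
  have hsupp' : ∀ (κ : Fin (d + 1)) (x : Site (d + 1)), x ∉ (nearBox L y).image (fun x' => x' + unitVec κ) →
      symMixKerAt (toSite r) L μ y (κ, x - unitVec κ) f f' = 0 := by
    intro κ x hx
    apply hsupp κ (x - unitVec κ)
    intro hmem
    exact hx (Finset.mem_image.2 ⟨x - unitVec κ, hmem, sub_add_cancel x (unitVec κ)⟩)
  have hs1 : ∀ κ : Fin (d + 1), Summable fun x : Site (d + 1) => symMixKerAt (toSite r) L μ y (κ, x - unitVec κ) f f' * G x :=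
    fun κ => summable_of_ne_finset_zero (s := (nearBox L y).image (fun x' => x' + unitVec κ)) fun x hx => by rw [hsupp' κ x hx, zero_mul]
  have hs2 : ∀ κ : Fin (d + 1), Summable fun x : Site (d + 1) => symMixKerAt (toSite r) L μ y (κ, x) f f' * G x :=
    fun κ => summable_of_ne_finset_zero (s := nearBox L y) fun x hx => by rw [hsupp κ x hx, zero_mul]
  have hs3 : ∀ κ : Fin (d + 1), Summable fun x : Site (d + 1) =>
      (symMixKerAt (toSite r) L μ y (κ, x - unitVec κ) f f' - symMixKerAt (toSite r) L μ y (κ, x) f f') * G x :=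
    fun κ => ((hs1 κ).sub (hs2 κ)).congr fun x => by ring
  have key : ∀ κ : Fin (d + 1), ∑ e ∈ offs L, symMixKerAt (toSite r) L μ y (κ, (L : ℤ) • y + e) f f' * (G ((L : ℤ) • y + e + unitVec κ) - G ((L : ℤ) • y + e)) =
      ∑' x : Site (d + 1), (symMixKerAt (toSite r) L μ y (κ, x - unitVec κ) f f' - symMixKerAt (toSite r) L μ y (κ, x) f f') * G x := by
    intro κ
    have hA : ∑' x : Site (d + 1), symMixKerAt (toSite r) L μ y (κ, x - unitVec κ) f f' * G x =
        ∑ e ∈ offs L, symMixKerAt (toSite r) L μ y (κ, (L : ℤ) • y + e) f f' * G ((L : ℤ) • y + e + unitVec κ) := by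
      rw [← (Equiv.addRight (unitVec κ)).tsum_eq (fun x : Site (d + 1) => symMixKerAt (toSite r) L μ y (κ, x - unitVec κ) f f' * G x)]
      simp only [Equiv.coe_addRight, add_sub_cancel_right]
      rw [tsum_eq_sum (s := nearBox L y) (fun x hx => by rw [hsupp κ x hx, zero_mul])]
      exact (sum_offs_eq_sum_nearBox y (fun x => symMixKerAt (toSite r) L μ y (κ, x) f f' * G (x + unitVec κ))).symm
    have hB : ∑' x : Site (d + 1), symMixKerAt (toSite r) L μ y (κ, x) f f' * G x =
        ∑ e ∈ offs L, symMixKerAt (toSite r) L μ y (κ, (L : ℤ) • y + e) f f' * G ((L : ℤ) • y + e) := by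
      rw [tsum_eq_sum (s := nearBox L y) (fun x hx => by rw [hsupp κ x hx, zero_mul])]
      exact (sum_offs_eq_sum_nearBox y (fun x => symMixKerAt (toSite r) L μ y (κ, x) f f' * G x)).symm
    calc ∑ e ∈ offs L, symMixKerAt (toSite r) L μ y (κ, (L : ℤ) • y + e) f f' * (G ((L : ℤ) • y + e + unitVec κ) - G ((L : ℤ) • y + e))
        = ∑ e ∈ offs L, symMixKerAt (toSite r) L μ y (κ, (L : ℤ) • y + e) f f' * G ((L : ℤ) • y + e + unitVec κ) -
            ∑ e ∈ offs L, symMixKerAt (toSite r) L μ y (κ, (L : ℤ) • y + e) f f' * G ((L : ℤ) • y + e) := by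
          simp only [mul_sub, Finset.sum_sub_distrib]
      _ = ∑' x : Site (d + 1), symMixKerAt (toSite r) L μ y (κ, x - unitVec κ) f f' * G x -
            ∑' x : Site (d + 1), symMixKerAt (toSite r) L μ y (κ, x) f f' * G x := by rw [hA, hB]
      _ = ∑' x : Site (d + 1), (symMixKerAt (toSite r) L μ y (κ, x - unitVec κ) f f' * G x - symMixKerAt (toSite r) L μ y (κ, x) f f' * G x) :=
          ((hs1 κ).tsum_sub (hs2 κ)).symm
      _ = _ := tsum_congr fun x => by ring
  have hsP : Summable fun x : Site (d + 1) => (if x = (L : ℤ) • y + toSite r then (1 : ℝ) else 0) * (2 * symHessKerAt (toSite r) L μ y f f' * G x) :=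
    summable_of_ne_finset_zero (s := {(L : ℤ) • y + toSite r}) fun x hx => by
      rw [Finset.mem_singleton] at hx; rw [if_neg hx, zero_mul]
  have hsQ : Summable fun x : Site (d + 1) => (if x = f.2 then (1 : ℝ) else 0) * (2 * symHessKerAt (toSite r) L μ y f f' * G x) :=
    summable_of_ne_finset_zero (s := {f.2}) fun x hx => by
      rw [Finset.mem_singleton] at hx; rw [if_neg hx, zero_mul]
  calc ∑ κ : Fin (d + 1), ∑ e ∈ offs L, symMixKerAt (toSite r) L μ y (κ, (L : ℤ) • y + e) f f' * (G ((L : ℤ) • y + e + unitVec κ) - G ((L : ℤ) • y + e))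
      = ∑ κ : Fin (d + 1), ∑' x : Site (d + 1), (symMixKerAt (toSite r) L μ y (κ, x - unitVec κ) f f' - symMixKerAt (toSite r) L μ y (κ, x) f f') * G x :=
        Finset.sum_congr rfl fun κ _ => key κ
    _ = ∑' x : Site (d + 1), ∑ κ : Fin (d + 1), (symMixKerAt (toSite r) L μ y (κ, x - unitVec κ) f f' - symMixKerAt (toSite r) L μ y (κ, x) f f') * G x :=
        (Summable.tsum_finsetSum fun κ _ => hs3 κ).symm
    _ = ∑' x : Site (d + 1), 2 * symHessKerAt (toSite r) L μ y f f' *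
          ((if x = (L : ℤ) • y + toSite r then (1 : ℝ) else 0) - (if x = f.2 then (1 : ℝ) else 0)) * G x := by
        refine tsum_congr fun x => ?_
        rw [← Finset.sum_mul, symMixKerAt_div_bg hL (toSite r) μ y x f f']
    _ = (∑' x : Site (d + 1), (if x = (L : ℤ) • y + toSite r then (1 : ℝ) else 0) * (2 * symHessKerAt (toSite r) L μ y f f' * G x)) -
          ∑' x : Site (d + 1), (if x = f.2 then (1 : ℝ) else 0) * (2 * symHessKerAt (toSite r) L μ y f f' * G x) := by
        rw [← hsP.tsum_sub hsQ]
        exact tsum_congr fun x => by ring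
    _ = 2 * symHessKerAt (toSite r) L μ y f f' * (G ((L : ℤ) • y + toSite r) - G f.2) := by
        rw [tsum_eq_single ((L : ℤ) • y + toSite r) (fun x hx => by rw [if_neg hx, zero_mul]),
          tsum_eq_single f.2 (fun x hx => by rw [if_neg hx, zero_mul]), if_pos rfl, if_pos rfl]
        ring


/-! ## §2 The graded composite mixed Ward law over the record's sym bricks, hypothesis-free -/

/-- [folklore] **THE SYMMETRISED MIXED WARD LAW OF THE GRADED COMPOSITE MIXED KERNEL OVER an1's (0.4)-SYMMETRISED BRICKS, ORDINARY FORM, EVERY DEPTH, HYPOTHESIS-FREE**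
(bricks `symLinKerAt ∕ symVhKerAt ∕ symHessKerAt ∕ symMixKerAt (toSite (r k)) L`, in-block roots, `1 ≤ L`; §1's window laws, antisymmetry `symHessKerAt_swap`):
`Σ_κ [(compMixKerG m μ y (κ, z − e_κ) f f′ − compMixKerG m μ y (κ, z) f f′) + (f ↔ f′)] = 2 · compVHKer ℓ 𝒽 L m μ y f f′ · ([f′.2 = z] − [f.2 = z])`. -/
theorem compMixKerG_div_bg_symm_sym (hL : 1 ≤ L) {r : ℕ → Fin (d + 1) → ℕ} (hr : ∀ k, r k ∈ box (d + 1) L) (z : Site (d + 1)) (m : ℕ)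
    (μ : Fin (d + 1)) (y : Site (d + 1)) (f f' : Bond (d + 1)) :
    ∑ κ₀ : Fin (d + 1),
        ((compMixKerG (fun k => symLinKerAt (toSite (r k)) L) (fun k => symVhKerAt (toSite (r k)) L) (fun k => symHessKerAt (toSite (r k)) L)
              (fun k => symMixKerAt (toSite (r k)) L) L m μ y (κ₀, z - unitVec κ₀) f f' -
            compMixKerG (fun k => symLinKerAt (toSite (r k)) L) (fun k => symVhKerAt (toSite (r k)) L) (fun k => symHessKerAt (toSite (r k)) L)
              (fun k => symMixKerAt (toSite (r k)) L) L m μ y (κ₀, z) f f') +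
          (compMixKerG (fun k => symLinKerAt (toSite (r k)) L) (fun k => symVhKerAt (toSite (r k)) L) (fun k => symHessKerAt (toSite (r k)) L)
              (fun k => symMixKerAt (toSite (r k)) L) L m μ y (κ₀, z - unitVec κ₀) f' f -
            compMixKerG (fun k => symLinKerAt (toSite (r k)) L) (fun k => symVhKerAt (toSite (r k)) L) (fun k => symHessKerAt (toSite (r k)) L)
              (fun k => symMixKerAt (toSite (r k)) L) L m μ y (κ₀, z) f' f)) =
      2 * compVHKer (fun k => symLinKerAt (toSite (r k)) L) (fun k => symHessKerAt (toSite (r k)) L) L m μ y f f' *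
        ((if f'.2 = z then (1 : ℝ) else 0) - (if f.2 = z then (1 : ℝ) else 0)) :=
  compMixKerG_div_bg_symm (ρ := fun k => toSite (r k)) (R := fun m => ∑ i ∈ Finset.range m, ((L ^ i : ℕ) : ℤ) • toSite (r i))
    (by simp) (fun m => by rw [Finset.sum_range_succ]) (fun k μ y G => symLinKerAt_window_dz hL (hr k) μ y G)
    (fun k μ y f G => symVhKerAt_window_dz hL (hr k) μ y f G) (fun k μ y f f' G => symMixKerAt_window_dz hL (hr k) μ y f f' G)
    (fun k μ y f f' => symHessKerAt_swap (toSite (r k)) L μ y f f') z m μ y f f'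

/-- [folklore] **AT THE RECORD's CENTRED ROOT** (`ctr (d+1) L = toSite (ctrOff (d+1) L)`, the same brick at every level — the shape of `CombMixedT2EvenGradedLetters`):
the graded composite mixed kernel of the (III′) literal's sym bricks obeys the symmetrised mixed Ward law in the ordinary form at every depth. -/
theorem compMixKerG_div_bg_symm_ctr (hL : 1 ≤ L) (z : Site (d + 1)) (m : ℕ) (μ : Fin (d + 1)) (y : Site (d + 1)) (f f' : Bond (d + 1)) :
    ∑ κ₀ : Fin (d + 1),
        ((compMixKerG (fun _ => symLinKerAt (AveragingContoursRooted.ctr (d + 1) L) L) (fun _ => symVhKerAt (AveragingContoursRooted.ctr (d + 1) L) L)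
              (fun _ => symHessKerAt (AveragingContoursRooted.ctr (d + 1) L) L) (fun _ => symMixKerAt (AveragingContoursRooted.ctr (d + 1) L) L) L m μ y
              (κ₀, z - unitVec κ₀) f f' -
            compMixKerG (fun _ => symLinKerAt (AveragingContoursRooted.ctr (d + 1) L) L) (fun _ => symVhKerAt (AveragingContoursRooted.ctr (d + 1) L) L)
              (fun _ => symHessKerAt (AveragingContoursRooted.ctr (d + 1) L) L) (fun _ => symMixKerAt (AveragingContoursRooted.ctr (d + 1) L) L) L m μ y
              (κ₀, z) f f') +
          (compMixKerG (fun _ => symLinKerAt (AveragingContoursRooted.ctr (d + 1) L) L) (fun _ => symVhKerAt (AveragingContoursRooted.ctr (d + 1) L) L)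
              (fun _ => symHessKerAt (AveragingContoursRooted.ctr (d + 1) L) L) (fun _ => symMixKerAt (AveragingContoursRooted.ctr (d + 1) L) L) L m μ y
              (κ₀, z - unitVec κ₀) f' f -
            compMixKerG (fun _ => symLinKerAt (AveragingContoursRooted.ctr (d + 1) L) L) (fun _ => symVhKerAt (AveragingContoursRooted.ctr (d + 1) L) L)
              (fun _ => symHessKerAt (AveragingContoursRooted.ctr (d + 1) L) L) (fun _ => symMixKerAt (AveragingContoursRooted.ctr (d + 1) L) L) L m μ y
              (κ₀, z) f' f)) =
      2 * compVHKer (fun _ => symLinKerAt (AveragingContoursRooted.ctr (d + 1) L) L) (fun _ => symHessKerAt (AveragingContoursRooted.ctr (d + 1) L) L) L m μ y f f' *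
        ((if f'.2 = z then (1 : ℝ) else 0) - (if f.2 = z then (1 : ℝ) else 0)) :=
  compMixKerG_div_bg_symm_sym hL (r := fun _ => AveragingContoursRooted.ctrOff (d + 1) L)
    (fun _ => AveragingContoursRooted.ctrOff_mem_box hL) z m μ y f f'

end Sym

end Summit.QuantumFields.BalabanUV.Beta.CompositeMixedWardGradedSym

end
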